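import Mathlib.CategoryTheory.Groupoid
import Mathlib.CategoryTheory.Products.Basic
import Literature.IUT.HodgeTheaters.FrobeniusEtalePictures
import HarnessLib

/-!
# [IUTchI] Corollary 3.9 (ii): the étale-picture plus units admits arbitrary permutation symmetries — PROOF

S. Mochizuki, *Inter-universal Teichmüller theory I*, §3, Corollary 3.9 (ii), p. 92 (kurims final
manuscript May 2020) [claim: Mochizuki2012, status: disputed]; cell node `IUTchI:Cor3.9(ii)`.
PROOF-ONLY companion of `Literature/IUT/HodgeTheaters/FrobeniusEtalePictures.lean` (statement module,
abc-iut-L5-t2) and `FrobeniusEtalePicturesProofs.lean` (abc-iut-L5-t12, which discharged Cor. 3.9 (i) and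
left (ii) CONDITIONAL on a joint lifting hypothesis for the pair `(D⊢_v, 𝒪^×_{C⊢_v})`); no definitions.

The point of this file: the permutation symmetry needs NO fullness hypothesis at all. For a Frobenius-picture
`{ⁿHT^Θ}_{n ∈ ℤ}` the poly-isomorphisms GENERATED by the chain of pair edges (Cor. 3.7 (ii)+(iii), same member
of the Θ-link on both components) are, between the vertices `a` and `b`, exactly the pairs
`((M.base v).mapIso θ, (M.units v).mapIso θ)` with
`θ = (ᵃcomponent_iso)⁻¹ ≫ (M.component v).mapIso ψ ≫ ᵇcomponent_iso` for `ψ` ranging over ALL isomorphisms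
`ᵃF⊩_mod ⥲ ᵇF⊩_mod` (`etalePictureUnits_eq_range`): this family is closed under identities, inverses and
composition, is "divisible" because any two `†F⊩_mod` are isomorphic (Def. 3.6 (c)), and each edge of the chain
IS the family for `(n, n+1)` (`thetaLinkPair_eq_range`: a member `φ : ⁿF⊩_tht ⥲ ⁿ⁺¹F⊩_mod` of the Θ-link
corresponds to `ψ = tautGlob ≫ φ`). Hence the generated poly-isomorphism between `a` and `b` depends only on the
two theaters `ᵃHT^Θ`, `ᵇHT^Θ` and not on the chain, and relabelling the chain by `σ ∈ Perm ℤ` yields the family for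
`(σ a, σ b)` — which is the typed statement `FrobeniusPicture.EtalePermutationSymmetricUnits`
(`etalePermutationSymmetricUnits_holds`, Cor. 3.9 (ii) DISCHARGED unconditionally over the interface). The same
argument re-proves Cor. 3.9 (i) without the interface law `componentBase_full`
(`etalePermutationSymmetric_holds'`). The abstract engine is `chainPolyIso_eq_range`: a `ℤ`-chain whose edges
are the images of the Hom-sets of a connected groupoid under a functor-like assignment generates exactly those
images. Nothing here bears on the disputed parts of the series; record only.
-/

namespace Literature.IUT.HodgeTheaters

open CategoryTheory

universe u v w uM

/-! ### Chains whose edges are images of a connected groupoid -/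

section Chain

variable {𝒞 : Type*} [Category 𝒞] {X : ℤ → 𝒞} {edge : ∀ n : ℤ, PolyIso (X n) (X (n + 1))}
  {𝒢 : Type*} [Category 𝒢] {G : ℤ → 𝒢} (P : ∀ a b : ℤ, (G a ≅ G b) → (X a ≅ X b))

/-- Every poly-isomorphism generated by the chain lies in a family `J a b ⊇ edge a` that contains the
identities and is closed under inverses and composition (induction on the generation).
[claim: Mochizuki2012, status: disputed] -/
theorem ChainGen.mem_of_family (J : ∀ a b : ℤ, PolyIso (X a) (X b)) (h_edge : ∀ n, edge n ⊆ J n (n + 1))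
    (h_refl : ∀ a, Iso.refl (X a) ∈ J a a)
    (h_symm : ∀ {a b : ℤ} {f : X a ≅ X b}, f ∈ J a b → f.symm ∈ J b a)
    (h_trans : ∀ {a b c : ℤ} {f : X a ≅ X b} {g : X b ≅ X c}, f ∈ J a b → g ∈ J b c → f ≪≫ g ∈ J a c)
    {a b : ℤ} {f : X a ≅ X b} (hf : ChainGen X edge a b f) : f ∈ J a b := by
  induction hf with
  | ofEdge hg => exact h_edge _ hg
  | refl a => exact h_refl a
  | symm _ ih => exact h_symm ih
  | trans _ _ ih₁ ih₂ => exact h_trans ih₁ ih₂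

/-- **The generated poly-isomorphisms of a chain of images.** If the edges of a `ℤ`-chain are the images
`{P ψ | ψ : G n ≅ G (n+1)}` of the Hom-sets of objects `G n` of a category in which any two `G a`, `G b` are
isomorphic, under an assignment `P` compatible with identities, inverses and composition, then the
poly-isomorphism generated between `a` and `b` is the image `{P ψ | ψ : G a ≅ G b}` — in particular it depends
only on the two ends, not on the chain. [claim: Mochizuki2012, status: disputed] -/
theorem chainPolyIso_eq_range (h_edge : ∀ n, edge n = Set.range (P n (n + 1)))
    (h_refl : ∀ a, P a a (Iso.refl (G a)) = Iso.refl (X a))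
    (h_symm : ∀ {a b : ℤ} (ψ : G a ≅ G b), P b a ψ.symm = (P a b ψ).symm)
    (h_trans : ∀ {a b c : ℤ} (ψ : G a ≅ G b) (ψ' : G b ≅ G c), P a c (ψ ≪≫ ψ') = P a b ψ ≪≫ P b c ψ')
    (h_conn : ∀ a b, Nonempty (G a ≅ G b)) (a b : ℤ) :
    chainPolyIso X edge a b = Set.range (P a b) := by
  ext f
  constructor
  · intro hf
    refine ChainGen.mem_of_family (fun a b => Set.range (P a b)) (fun n => (h_edge n).le) ?_ ?_ ?_ hf
    · intro a; exact ⟨Iso.refl _, h_refl a⟩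
    · rintro a b f ⟨ψ, rfl⟩; exact ⟨ψ.symm, h_symm ψ⟩
    · rintro a b c f g ⟨ψ, rfl⟩ ⟨ψ', rfl⟩; exact ⟨ψ ≪≫ ψ', h_trans ψ ψ'⟩
  · -- divisibility: `P ψ = P ψ₀ ≫ P (ψ₀⁻¹ ≫ ψ)` for any `ψ₀ : G a ≅ G c`
    have h_div : ∀ {a b : ℤ} (c : ℤ) (ψ : G a ≅ G b), ∃ (ψ₀ : G a ≅ G c) (ψ₁ : G c ≅ G b),
        P a b ψ = P a c ψ₀ ≪≫ P c b ψ₁ := by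
      intro a b c ψ
      obtain ⟨ψ₀⟩ := h_conn a c
      exact ⟨ψ₀, ψ₀.symm ≪≫ ψ, by rw [← h_trans, Iso.self_symm_id_assoc]⟩
    have fwd : ∀ (a b : ℤ), a ≤ b → ∀ ψ : G a ≅ G b, ChainGen X edge a b (P a b ψ) := by
      intro a b hab
      induction b, hab using Int.leInduction with
      | base =>
        intro ψ
        obtain ⟨ψ₀, ψ₁, h⟩ := h_div (a + 1) ψ
        rw [h]
        refine ChainGen.trans (ChainGen.ofEdge (by rw [h_edge]; exact ⟨ψ₀, rfl⟩)) ?_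
        have h₁ : ChainGen X edge a (a + 1) (P a (a + 1) ψ₁.symm) :=
          ChainGen.ofEdge (by rw [h_edge]; exact ⟨ψ₁.symm, rfl⟩)
        have h₂ := ChainGen.symm h₁
        rwa [h_symm, Iso.symm_symm_eq] at h₂
      | succ n hmn ih =>
        intro ψ
        obtain ⟨ψ₀, ψ₁, h⟩ := h_div n ψ
        rw [h]
        exact ChainGen.trans (ih ψ₀) (ChainGen.ofEdge (by rw [h_edge]; exact ⟨ψ₁, rfl⟩))
    rintro ⟨ψ, rfl⟩
    rcases le_total a b with hab | hba
    · exact fwd a b hab ψ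
    · have h := ChainGen.symm (fwd b a hba ψ.symm)
      rw [h_symm, Iso.symm_symm_eq] at h
      exact h

end Chain

/-! ### Corollary 3.7 (ii), (iii): the induced poly-isomorphisms, computed -/

section Cor37

variable {F : Type u} {K : Type v} {Fbar : Type w} [Field F] [NumberField F] [Field K]
  [NumberField K] [Algebra F K] [Field Fbar] [Algebra F Fbar] [Algebra K Fbar]
  {E : WeierstrassCurve F} [E.IsElliptic] {l : ℕ} {P : BadPlacePredicates K}
  {D : InitialThetaData F K Fbar E l P} {M : HodgeTheaterModel D} (HT HT' : ThetaHodgeTheater M)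

namespace ThetaHodgeTheater

/-- **Cor. 3.7 (ii)+(iii), computed**: the pair poly-isomorphism `(†D⊢_v, 𝒪^×_{†C⊢_v}) ⥲ (‡D⊢_v, 𝒪^×_{‡C⊢_v})`
induced by the Θ-link is the set of pairs `((M.base v).mapIso θ, (M.units v).mapIso θ)`,
`θ = (†component_iso)⁻¹ ≫ (M.component v).mapIso ψ ≫ ‡component_iso`, over ALL `ψ : †F⊩_mod ⥲ ‡F⊩_mod` (the Θ-link
being the full poly-isomorphism and `†F⊩_mod ⥲ †F⊩_tht` an isomorphism, a member `φ` of the Θ-link corresponds to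
`ψ = tautGlob ≫ φ`; the tautological isomorphisms `†F⊢_v ⥲ †F^Θ_v` cancel). [claim: Mochizuki2012, status: disputed] -/
theorem thetaLinkPair_eq_range (v : D.V) :
    HT.thetaLinkPair HT' v =
      Set.range (fun ψ : HT.glob ≅ HT'.glob =>
        Iso.prod
          ((M.base v).mapIso
            ((HT.component_iso v).symm ≪≫ (M.component v).mapIso ψ ≪≫ HT'.component_iso v))
          ((M.units v).mapIso
            ((HT.component_iso v).symm ≪≫ (M.component v).mapIso ψ ≪≫ HT'.component_iso v))) := by
  delta ThetaHodgeTheater.thetaLinkPair ThetaHodgeTheater.thetaLink ThetaHodgeTheater.tautBase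
    ThetaHodgeTheater.tautUnits ThetaHodgeTheater.linkComponent ThetaHodgeTheater.componentFtht
    ThetaHodgeTheater.Ddash ThetaHodgeTheater.Dtheta ThetaHodgeTheater.unitsDash ThetaHodgeTheater.unitsTheta
    ThetaHodgeTheater.Ftheta ThetaHodgeTheater.Fdash ThetaHodgeTheater.Ftht
  ext h
  constructor
  · rintro ⟨φ, -, rfl⟩
    refine ⟨M.tautGlob.app HT.glob ≪≫ φ, ?_⟩
    ext <;> simp
  · rintro ⟨ψ, rfl⟩
    refine ⟨(M.tautGlob.app HT.glob).symm ≪≫ ψ, Set.mem_univ _, ?_⟩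
    ext <;> simp

/-- **Cor. 3.7 (ii), computed** (base component alone): `†D⊢_v ⥲ ‡D⊢_v` is the set of the
`(M.base v).mapIso θ`, `θ` as above. [claim: Mochizuki2012, status: disputed] -/
theorem thetaLinkBase_eq_range (v : D.V) :
    HT.thetaLinkBase HT' v =
      Set.range (fun ψ : HT.glob ≅ HT'.glob =>
        (M.base v).mapIso
          ((HT.component_iso v).symm ≪≫ (M.component v).mapIso ψ ≪≫ HT'.component_iso v)) := by
  delta ThetaHodgeTheater.thetaLinkBase ThetaHodgeTheater.thetaLink ThetaHodgeTheater.tautBase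
    ThetaHodgeTheater.linkComponent ThetaHodgeTheater.componentFtht
    ThetaHodgeTheater.Ddash ThetaHodgeTheater.Dtheta ThetaHodgeTheater.Ftheta ThetaHodgeTheater.Fdash
    ThetaHodgeTheater.Ftht
  ext h
  constructor
  · rintro ⟨φ, -, rfl⟩
    refine ⟨M.tautGlob.app HT.glob ≪≫ φ, ?_⟩
    ext
    simp
  · rintro ⟨ψ, rfl⟩
    refine ⟨(M.tautGlob.app HT.glob).symm ≪≫ ψ, Set.mem_univ _, ?_⟩
    ext
    simp

end ThetaHodgeTheater

end Cor37

/-! ### Corollary 3.9 (i), (ii): the étale-pictures computed; permutation symmetries -/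

section Pictures

variable {F : Type u} {K : Type v} {Fbar : Type w} [Field F] [NumberField F] [Field K]
  [NumberField K] [Algebra F K] [Field Fbar] [Algebra F Fbar] [Algebra K Fbar]
  {E : WeierstrassCurve F} [E.IsElliptic] {l : ℕ} {P : BadPlacePredicates K}
  {D : InitialThetaData F K Fbar E l P} {M : HodgeTheaterModel D} (Fr : FrobeniusPicture M)

namespace FrobeniusPicture

/-- Any two `ⁿF⊩_mod`, `ᵐF⊩_mod` of a Frobenius-picture are isomorphic (both are isomorphic to `F⊩_mod`,
Def. 3.6 (c)). [claim: Mochizuki2012, status: disputed] -/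
theorem nonempty_globIso (a b : ℤ) : Nonempty ((Fr.HT a).glob ≅ (Fr.HT b).glob) := by
  obtain ⟨e⟩ := (Fr.HT a).glob_iso
  obtain ⟨e'⟩ := (Fr.HT b).glob_iso
  exact ⟨e ≪≫ e'.symm⟩

/-- **Cor. 3.9 (ii), computed**: the poly-isomorphism of the étale-picture plus units between the vertices
`a` and `b` is the set of pairs `((M.base v).mapIso θ, (M.units v).mapIso θ)`,
`θ = (ᵃcomponent_iso)⁻¹ ≫ (M.component v).mapIso ψ ≫ ᵇcomponent_iso`, over all `ψ : ᵃF⊩_mod ⥲ ᵇF⊩_mod` — it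
depends only on `ᵃHT^Θ`, `ᵇHT^Θ`, not on the chain. [claim: Mochizuki2012, status: disputed] -/
theorem etalePictureUnits_eq_range (v : D.V) (a b : ℤ) :
    Fr.etalePictureUnits v a b =
      Set.range (fun ψ : (Fr.HT a).glob ≅ (Fr.HT b).glob =>
        Iso.prod
          ((M.base v).mapIso
            (((Fr.HT a).component_iso v).symm ≪≫ (M.component v).mapIso ψ ≪≫ (Fr.HT b).component_iso v))
          ((M.units v).mapIso
            (((Fr.HT a).component_iso v).symm ≪≫ (M.component v).mapIso ψ ≪≫
              (Fr.HT b).component_iso v))) := by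
  refine chainPolyIso_eq_range (G := fun n => (Fr.HT n).glob)
    (fun a b (ψ : (Fr.HT a).glob ≅ (Fr.HT b).glob) =>
      Iso.prod
        ((M.base v).mapIso
          (((Fr.HT a).component_iso v).symm ≪≫ (M.component v).mapIso ψ ≪≫ (Fr.HT b).component_iso v))
        ((M.units v).mapIso
          (((Fr.HT a).component_iso v).symm ≪≫ (M.component v).mapIso ψ ≪≫ (Fr.HT b).component_iso v)))
    (fun n => (Fr.HT n).thetaLinkPair_eq_range (Fr.HT (n + 1)) v) ?_ ?_ ?_ Fr.nonempty_globIso a b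
  · intro a
    ext <;> simp
  · intro a b ψ
    ext <;> simp
  · intro a b c ψ ψ'
    ext <;> simp

/-- **Cor. 3.9 (i), computed**: the poly-isomorphism `ᵃD⊢_v ⥲ ᵇD⊢_v` of the étale-picture is the set of the
`(M.base v).mapIso θ`, `θ` as above — independent of the chain. [claim: Mochizuki2012, status: disputed] -/
theorem etalePicture_eq_range (v : D.V) (a b : ℤ) :
    Fr.etalePicture v a b =
      Set.range (fun ψ : (Fr.HT a).glob ≅ (Fr.HT b).glob =>
        (M.base v).mapIso
          (((Fr.HT a).component_iso v).symm ≪≫ (M.component v).mapIso ψ ≪≫ (Fr.HT b).component_iso v)) := by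
  refine chainPolyIso_eq_range (G := fun n => (Fr.HT n).glob)
    (fun a b (ψ : (Fr.HT a).glob ≅ (Fr.HT b).glob) =>
      (M.base v).mapIso
        (((Fr.HT a).component_iso v).symm ≪≫ (M.component v).mapIso ψ ≪≫ (Fr.HT b).component_iso v))
    (fun n => (Fr.HT n).thetaLinkBase_eq_range (Fr.HT (n + 1)) v) ?_ ?_ ?_ Fr.nonempty_globIso a b
  · intro a
    ext; simp
  · intro a b ψ
    ext; simp
  · intro a b c ψ ψ'
    ext; simp

/-- **[IUTchI] Corollary 3.9 (ii) — DISCHARGED** (p. 92: "just as in the case of (i), this diagram admits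
arbitrary permutation symmetries among the labels `n ∈ ℤ`"): for every Frobenius-picture and every `v ∈ V̲`,
relabelling the chain by any `σ ∈ Perm ℤ` does not change the poly-isomorphisms of the étale-picture plus
units. Unconditional over the interface `HodgeTheaterModel`: no fullness law is used.
[claim: Mochizuki2012, status: disputed] -/
theorem etalePermutationSymmetricUnits_holds (v : D.V) :
    Literature.IUT.HodgeTheaters.FrobeniusPicture.EtalePermutationSymmetricUnits Fr v := by
  intro σ a b
  rw [(Fr.relabel σ).etalePictureUnits_eq_range v a b, Fr.etalePictureUnits_eq_range v (σ a) (σ b)]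
  rfl

/-- **[IUTchI] Corollary 3.9 (i), permutation symmetry — law-free proof** ("the étale-picture [unlike the
Frobenius-picture!] admits arbitrary permutation symmetries among the labels `n ∈ ℤ`"): the same, for the
étale-picture of the `ⁿD⊢_v`; this proof does not use the interface law `componentBase_full` (contrast
`etalePermutationSymmetric_holds`). [claim: Mochizuki2012, status: disputed] -/
theorem etalePermutationSymmetric_holds' (v : D.V) :
    Literature.IUT.HodgeTheaters.FrobeniusPicture.EtalePermutationSymmetric Fr v := by
  intro σ a b
  rw [(Fr.relabel σ).etalePicture_eq_range v a b, Fr.etalePicture_eq_range v (σ a) (σ b)]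
  rfl

end FrobeniusPicture

end Pictures

end Literature.IUT.HodgeTheaters
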